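import Mathlib.Tactic.Ring
import Literature.Algebra.EuclideanDomain.TransfiniteSmallestAlgorithm
import HarnessLib

/-!
# The transfinite smallest algorithm: its values form an initial segment of the ordinals, and it is superadditive
# on a domain (Conidis–Nielsen–Tombs 2019, Proposition 4 and Lemma 5 = Lenstra's Proposition 3.4)

Topic `Literature/Algebra/EuclideanDomain`, namespace `Literature.Algebra.EuclideanDomain`.  THEOREMS ONLY (no `def`, no
instance, no named fact), all proved, in the vocabulary of `TransfiniteSmallestAlgorithm.lean` (`samuelSet R α = A_α`,
Samuel's transfinite construction; `samuelRank x = θ(x)`, the smallest algorithm).  The finitely valued case of the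
superadditivity is `MinimalEuclideanFunctionSuperadditive.lean` (`motzkinNorm_add_le_motzkinNorm_mul`).

## Sources (read at the page)

C. J. Conidis, P. P. Nielsen, V. Tombs, *Transfinitely valued Euclidean domains have arbitrary indecomposable order
type*, Comm. Algebra **47** (2019) [ConidisNielsenTombs2019] (materialised `paper:arxiv-1703.02631`, §3 p0005),
VERBATIM.  Their sets are `S_α(R) = {d ∈ R : for each n ∈ R, either d ∣ n or there exist q ∈ R and β < α such that
n − qd ∈ S_β(R)}` («Notice that `S₀(R)` is the set of units … if `S_β(R) = S_{β+1}(R)`, then `S_β(R) = S_α(R)` for all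
`α ≥ β`.  Thus, there is a smallest ordinal `ρ(R)` at which this sequence of subsets stabilizes»).  **Proposition 4.**
«The following are equivalent for any ring `R`: (1) `S_α(R) = R` for some `α ∈ Ord`.  (2) `R` is a Euclidean domain.
If these conditions hold, then it also happens that: • The function `τ : R∖{0} → Ord` given by the rule
`τ(x) = min{α ∈ Ord : x ∈ S_α(R)}` is a Euclidean norm on `R`.  • `τ` is minimal … • `τ(R∖{0}) = ρ(R)` is the Euclidean
order type of `R`, and `0 ∈ S_α(R)` if and only if `α ≥ ρ(R)`.»  **Lemma 5.** «Let `R` be a Euclidean domain with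
minimal Euclidean norm `τ`.  If `x, y ∈ R∖{0}`, then `τ(xy) ≥ τ(x) ⊕ τ(y)`» («Proposition 3.4 in Lenstra's lecture notes
[Lenstra] … established the result forty years earlier (by essentially the same proof, which we therefore do not
include)»).  P. Samuel, *About Euclidean rings*, J. Algebra **19** (1971) [Samuel1971], §4 (p. 289): the construction
`A_α` and «`θ(x) = α ⟺ x ∈ A_α − A_α′`» (4.3).

## Dictionary and what is formalised

For `x ≠ 0`: `x ∈ S_α(R) ⟺ x ∈ A_{1+α}` (the two constructions differ only in the bookkeeping of `0`: Samuel puts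
`0 ∈ A₀`, Conidis–Nielsen–Tombs adjoin `0` at stage `ρ(R)`), hence `θ(x) = 1 + τ(x)` (ordinal sum: `θ = τ + 1` for
finite values, `θ = τ` from `ω` on) and `τ(x) = θ(x) − 1` (ordinal subtraction, `Ordinal.add_sub_cancel_of_le`).
* §1 «`τ(R∖{0}) = ρ(R)`» — THE VALUES OF `θ` FORM AN INITIAL SEGMENT: if no element has `θ = α` then
  `A_{α+1} = A_α` and the sequence is stationary from `α` on (`samuelSet_add_one_eq_of_forall_samuelRank_ne`); hence
  every `α < θ(x)` (`x ∈ A′`) is a value `θ(y)` (`exists_samuelRank_eq_of_lt`).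
* §2 LEMMA 5 (domain), with the ORDINAL sum: `(θ(x) − 1) + (θ(y) − 1) ≤ θ(xy) − 1` for `x, y ≠ 0`
  (`samuelRank_sub_one_add_le`; by symmetry also with the summands exchanged), by Lenstra's induction on `θ(xy)`: if
  `θ(xy) − 1 < (θ(x) − 1) + (θ(y) − 1)` then either `θ(xy) − 1 < θ(x) − 1` — take a class `c + xR` avoiding
  `⋃_{β<γ} A_β`, `γ = 1 + (θ(xy) − 1) < θ(x)`; the class of `cy` mod `xy` has a representative `w = (c − xt)y` with
  `θ(w) < θ(xy)`, while `θ(c − xt) ≥ γ`, contradicting the induction hypothesis for `w` — or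
  `θ(xy) − 1 = (θ(x) − 1) + b′` with `b′ < θ(y) − 1`, symmetric with a class mod `y`.  Powers:
  `(θ(x) − 1)·n ≤ θ(xⁿ) − 1` (`samuelRank_sub_one_mul_le`).
-- TODO(general form): Lemma 5 with the Hessenberg natural sum `τ(x) ⊕ τ(y)` (≥ both ordinal sums); Mathlib's natural
-- operations on ordinals (`Ordinal.nadd`) are not available at this pin, and Corollary 6 (the Euclidean order type is
-- an indecomposable ordinal) is left for a sequel.

## Mathlib / tree search

Mathlib: ordinal subtraction (`Ordinal.add_sub_cancel_of_le`, `Ordinal.le_sub_of_add_le`, `add_lt_add_iff_left`),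
`WellFoundedLT.induction`.  Tree: `TransfiniteSmallestAlgorithm.lean` (`mem_samuelSet_iff`, `samuelSet_mono`,
`mem_samuelSet_add_one_iff`, `samuelSet_eq_of_add_one_eq`, `mem_samuelSet_samuelRank`, `samuelRank_le_of_mem`,
`samuelRank_eq_zero_iff`, `forall_of_mem_samuelSet`), `MinimalEuclideanFunctionSuperadditive.lean` (finite case),
`MinimalEuclideanFunctionSuperadditiveNonZeroDivisors.lean` (finite case beyond domains; why a domain is needed).
-/

namespace Literature.Algebra.EuclideanDomain

universe u

variable {R : Type u} [CommRing R]

/-! ## §1 The values of `θ` form an initial segment of the ordinals -/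

/-- If no element of `A′` has `θ = α`, then `A_{α+1} = A_α` («if `S_β(R) = S_{β+1}(R)` …» — the representatives
`r ∈ A_α` of the classes mod `b ∈ A_{α+1}` have `θ(r) < α`, so lie in earlier stages).
[cite: ConidisNielsenTombs2019, Prop. 4 (§3); Samuel1971, §4 (4.3) (p. 289)] -/
theorem samuelSet_add_one_eq_of_forall_samuelRank_ne {α : Ordinal.{u}}
    (hα : ∀ y : R, (∃ β : Ordinal.{u}, y ∈ samuelSet R β) → samuelRank y ≠ α) :
    samuelSet R (α + 1) = samuelSet R α := by
  refine le_antisymm (fun b hb ↦ ?_) (samuelSet_mono (lt_add_one α).le)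
  rcases mem_samuelSet_add_one_iff.1 hb with hb | hb
  · exact hb
  · refine mem_samuelSet_of_forall fun a ↦ ?_
    obtain ⟨r, hr, hd⟩ := hb a
    exact ⟨samuelRank r, lt_of_le_of_ne (samuelRank_le_of_mem hr) (hα r ⟨α, hr⟩), r,
      mem_samuelSet_samuelRank ⟨α, hr⟩, hd⟩

/-- **«`τ(R∖{0}) = ρ(R)`» — the values of the smallest algorithm form an initial segment of the ordinals**: every
`α < θ(x)` (`x ∈ A′`) is the value `θ(y)` of some `y ∈ A′` (otherwise the sequence would be stationary from `α` on and
`x ∈ A_α`). [cite: ConidisNielsenTombs2019, Prop. 4 (§3)] -/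
theorem exists_samuelRank_eq_of_lt {x : R} (hx : ∃ β : Ordinal.{u}, x ∈ samuelSet R β) {α : Ordinal.{u}}
    (hα : α < samuelRank x) :
    ∃ y : R, (∃ β : Ordinal.{u}, y ∈ samuelSet R β) ∧ samuelRank y = α := by
  by_contra hne
  push Not at hne
  have hstab := samuelSet_add_one_eq_of_forall_samuelRank_ne (R := R) hne
  have hxα : x ∈ samuelSet R α := by
    rw [← samuelSet_eq_of_add_one_eq hstab hα.le]
    exact mem_samuelSet_samuelRank hx
  exact absurd hα (not_lt.2 (samuelRank_le_of_mem hxα))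

/-- In particular, below the value of any element every ordinal is attained: with global exhaustion, `α < θ(x)`
gives `y` with `θ(y) = α`. [cite: ConidisNielsenTombs2019, Prop. 4 (§3)] -/
theorem exists_samuelRank_eq_of_lt' (h : ∀ z : R, ∃ β : Ordinal.{u}, z ∈ samuelSet R β) {x : R}
    {α : Ordinal.{u}} (hα : α < samuelRank x) : ∃ y : R, samuelRank y = α := by
  obtain ⟨y, -, hy⟩ := exists_samuelRank_eq_of_lt (h x) hα
  exact ⟨y, hy⟩

/-! ## §2 Lemma 5 (Lenstra): superadditivity on a domain -/

section Domain

variable [IsDomain R]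

omit [IsDomain R] in
/-- A class `c + xR` avoiding all stages below `γ`, for `γ < θ(x)`: its elements `z` are non-zero and have
`θ(z) ≥ γ`. [cite: Samuel1971, §4 (p. 289); ConidisNielsenTombs2019, Lemma 5 (§3)] -/
theorem exists_coset_forall_le_samuelRank (h : ∀ z : R, ∃ β : Ordinal.{u}, z ∈ samuelSet R β) {x : R}
    {γ : Ordinal.{u}} (hγ : γ < samuelRank x) (hγ0 : 0 < γ) :
    ∃ c : R, ∀ t : R, c + x * t ≠ 0 ∧ γ ≤ samuelRank (c + x * t) := by
  have hx : x ∉ samuelSet R γ := not_mem_samuelSet_of_lt_samuelRank hγ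
  rw [mem_samuelSet_iff, not_or] at hx
  obtain ⟨-, hx⟩ := hx
  push Not at hx
  obtain ⟨c, hc⟩ := hx
  refine ⟨c, fun t ↦ ?_⟩
  -- `z = c + xt` lies in no `A_β`, `β < γ`
  have hz : ∀ β < γ, c + x * t ∉ samuelSet R β := fun β hβ hmem ↦
    hc β hβ (c + x * t) hmem ⟨-t, by ring⟩
  refine ⟨fun h0 ↦ hz 0 hγ0 (h0 ▸ zero_mem_samuelSet 0), not_lt.1 fun hlt ↦ hz _ hlt ?_⟩
  exact mem_samuelSet_samuelRank (h _)

omit [IsDomain R] in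
/-- `θ(z) ≥ 1` for `z ≠ 0`, so that `1 + (θ(z) − 1) = θ(z)`. [cite: Samuel1971, §4 (4.1) (p. 288)] -/
theorem one_add_samuelRank_sub_one (h : ∀ z : R, ∃ β : Ordinal.{u}, z ∈ samuelSet R β) {z : R} (hz : z ≠ 0) :
    1 + (samuelRank z - 1) = samuelRank z :=
  Ordinal.add_sub_cancel_of_le (Order.one_le_iff_ne_zero.2 fun e ↦ hz ((samuelRank_eq_zero_iff (h z)).1 e))

/-- **Lemma 5 (Lenstra's Proposition 3.4), transfinite, with the ordinal sum**: on a domain exhausted by its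
transfinite construction, `(θ(x) − 1) + (θ(y) − 1) ≤ θ(xy) − 1` for `x, y ≠ 0` — i.e. `τ(x) + τ(y) ≤ τ(xy)` for the
minimal norm `τ = θ − 1`; the printed `τ(x) ⊕ τ(y) ≤ τ(xy)` with the natural sum implies this and is proved by the same
induction on `θ(xy)`. [cite: ConidisNielsenTombs2019, Lemma 5 (§3)] -/
theorem samuelRank_sub_one_add_le (h : ∀ z : R, ∃ β : Ordinal.{u}, z ∈ samuelSet R β) {x y : R} (hx : x ≠ 0)
    (hy : y ≠ 0) : (samuelRank x - 1) + (samuelRank y - 1) ≤ samuelRank (x * y) - 1 := by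
  suffices H : ∀ o : Ordinal.{u}, ∀ x y : R, x ≠ 0 → y ≠ 0 → samuelRank (x * y) = o →
      (samuelRank x - 1) + (samuelRank y - 1) ≤ o - 1 from H _ x y hx hy rfl
  intro o
  induction o using WellFoundedLT.induction with
  | ind o ih =>
    intro x y hx hy hxy
    have hxy0 : x * y ≠ 0 := mul_ne_zero hx hy
    by_contra hlt
    rw [not_le] at hlt
    -- the representative trick: a class mod `xy` built from a class mod `x` (resp. `y`)
    have key : ∀ (u v : R), u ≠ 0 → v ≠ 0 → u * v = x * y → ∀ γ : Ordinal.{u}, 0 < γ → γ < samuelRank u →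
        ∃ z w : R, z ≠ 0 ∧ γ ≤ samuelRank z ∧ w = z * v ∧ samuelRank w < o := by
      intro u v hu hv huv γ hγ0 hγ
      obtain ⟨c, hc⟩ := exists_coset_forall_le_samuelRank h hγ hγ0
      -- the class of `cv` mod `uv = xy` has a representative `w ∈ A_β`, `β < o`
      have hmem : x * y ∈ samuelSet R (samuelRank (x * y)) := mem_samuelSet_samuelRank (h _)
      obtain ⟨β, hβ, w, hw, t, ht⟩ := forall_of_mem_samuelSet hmem hxy0 (c * v)
      refine ⟨c + u * (-t), w, (hc (-t)).1, (hc (-t)).2, ?_, ?_⟩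
      · -- `w = cv − xyt = (c − ut)v`
        rw [← huv] at ht
        linear_combination -ht
      · exact hxy ▸ (samuelRank_le_of_mem hw).trans_lt hβ
    have ho1 : 1 + (o - 1) = o := hxy ▸ one_add_samuelRank_sub_one h hxy0
    rcases lt_or_ge (o - 1) (samuelRank x - 1) with h1 | h1
    · -- Case 1: `o − 1 < θ(x) − 1`; `γ = 1 + (o − 1) = o < θ(x)`
      have hγ : o < samuelRank x := by
        rw [← ho1, ← one_add_samuelRank_sub_one h hx]
        exact (add_lt_add_iff_left 1).2 h1
      have ho0 : 0 < o := by rw [← ho1]; exact lt_of_lt_of_le zero_lt_one le_self_add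
      obtain ⟨z, w, hz0, hzγ, hw, hwo⟩ := key x y hx hy rfl o ho0 hγ
      have hw0 : w ≠ 0 := by rw [hw]; exact mul_ne_zero hz0 hy
      have IH := ih (samuelRank w) hwo z y hz0 hy (by rw [hw])
      -- `o − 1 ≤ θ(z) − 1`, so `o − 1 ≤ (θ z − 1) + (θ y − 1) ≤ θ w − 1 < o − 1`
      have hz1 : o - 1 ≤ samuelRank z - 1 :=
        Ordinal.le_sub_of_add_le (by rw [ho1]; exact hzγ)
      have hwo' : samuelRank w - 1 < o - 1 := by
        rw [← add_lt_add_iff_left 1, one_add_samuelRank_sub_one h hw0, ho1]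
        exact hwo
      exact absurd ((hz1.trans le_self_add).trans IH) (not_le.2 hwo')
    · -- Case 2: `θ(x) − 1 ≤ o − 1 < (θ x − 1) + (θ y − 1)`; `b′ = (o − 1) − (θ x − 1) < θ y − 1`
      set b' := o - 1 - (samuelRank x - 1) with hb'
      have hob : samuelRank x - 1 + b' = o - 1 := Ordinal.add_sub_cancel_of_le h1
      have hb'lt : b' < samuelRank y - 1 := by
        rw [← add_lt_add_iff_left (samuelRank x - 1), hob]
        exact hlt
      have hγ : 1 + b' < samuelRank y := by
        rw [← one_add_samuelRank_sub_one h hy]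
        exact (add_lt_add_iff_left 1).2 hb'lt
      have hγ0 : 0 < 1 + b' := lt_of_lt_of_le zero_lt_one le_self_add
      obtain ⟨z, w, hz0, hzγ, hw, hwo⟩ := key y x hy hx (mul_comm y x) (1 + b') hγ0 hγ
      have hw0 : w ≠ 0 := by rw [hw]; exact mul_ne_zero hz0 hx
      have IH := ih (samuelRank w) hwo x z hx hz0 (by rw [hw, mul_comm])
      have hz1 : b' ≤ samuelRank z - 1 := Ordinal.le_sub_of_add_le hzγ
      have hwo' : samuelRank w - 1 < o - 1 := by
        rw [← add_lt_add_iff_left 1, one_add_samuelRank_sub_one h hw0, ho1]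
        exact hwo
      have : o - 1 ≤ samuelRank x - 1 + (samuelRank z - 1) := by
        rw [← hob]
        exact add_le_add le_rfl hz1
      exact absurd (this.trans IH) (not_le.2 hwo')

/-- Lemma 5 with the summands exchanged: `(θ(y) − 1) + (θ(x) − 1) ≤ θ(xy) − 1` (the natural sum dominates both
ordinal sums). [cite: ConidisNielsenTombs2019, Lemma 5 (§3)] -/
theorem samuelRank_sub_one_add_le' (h : ∀ z : R, ∃ β : Ordinal.{u}, z ∈ samuelSet R β) {x y : R} (hx : x ≠ 0)
    (hy : y ≠ 0) : (samuelRank y - 1) + (samuelRank x - 1) ≤ samuelRank (x * y) - 1 := by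
  rw [mul_comm]
  exact samuelRank_sub_one_add_le h hy hx

/-- Powers: `(θ(x) − 1)·n ≤ θ(xⁿ) − 1`, i.e. `τ(xⁿ) ≥ τ(x)·n` (the case `⊕_{i≤n} τ(x) = τ(x)·n` used in Corollary 6).
[cite: ConidisNielsenTombs2019, Lemma 5 and Cor. 6 (§3)] -/
theorem samuelRank_sub_one_mul_le (h : ∀ z : R, ∃ β : Ordinal.{u}, z ∈ samuelSet R β) {x : R} (hx : x ≠ 0)
    (n : ℕ) : (samuelRank x - 1) * n ≤ samuelRank (x ^ n) - 1 := by
  induction n with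
  | zero => rw [Nat.cast_zero, mul_zero]; exact bot_le
  | succ n ih =>
    rw [Nat.cast_succ, mul_add_one, pow_succ]
    have hstep := samuelRank_sub_one_add_le h (pow_ne_zero n hx) hx
    exact (add_le_add ih le_rfl).trans hstep

/-- The weak form without subtraction: `θ(x) + (θ(y) − 1) ≤ θ(xy)` for `x, y ≠ 0`.
[cite: ConidisNielsenTombs2019, Lemma 5 (§3)] -/
theorem samuelRank_add_sub_one_le (h : ∀ z : R, ∃ β : Ordinal.{u}, z ∈ samuelSet R β) {x y : R} (hx : x ≠ 0)
    (hy : y ≠ 0) : samuelRank x + (samuelRank y - 1) ≤ samuelRank (x * y) := by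
  have := samuelRank_sub_one_add_le h hx hy
  calc samuelRank x + (samuelRank y - 1)
      = 1 + ((samuelRank x - 1) + (samuelRank y - 1)) := by
        rw [← add_assoc, one_add_samuelRank_sub_one h hx]
    _ ≤ 1 + (samuelRank (x * y) - 1) := add_le_add le_rfl this
    _ = samuelRank (x * y) := one_add_samuelRank_sub_one h (mul_ne_zero hx hy)

end Domain

end Literature.Algebra.EuclideanDomain
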